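import Summits.BirchSwinnertonDyer.BirchSwinnertonDyer.Theorems.Rank2ObservatoryRank3RootNumberCensus
import Summits.BirchSwinnertonDyer.BirchSwinnertonDyer.Theorems.Rank2ObservatoryConductorCert
import HarnessLib

/-!
# BSD rank ≥ 2 observatory (`b2b-bsdr2`): the rank-3 census with the CONDUCTOR hypothesis
# discharged for the tame rows (kernel, modulo the tree's named facts on conductor exponents)

HONEST FRAMING: per-curve certified theorems and census instruments; no claim on BSD in rank ≥ 2.

The census theorem `Rank3Row.rank3_lderiv_eq_zero_kernel_rn` (`L′(E,1) = 0` by Gross–Zagier–Kolyvagin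
over the Heegner field) takes `hN : E.conductorNorm ℤ = N` — the identification of the table's
conductor with the curve's — as a hypothesis. For the `5347` TAME rows of the census (no additive
reduction at `2` or `3`: `2 ∤ Δ` or `2 ∤ c₄`, and every odd additive prime `≥ 5`) the landed
root-number certificate `c` (chunks `Rank2ObservatoryRank3RootNumberCertsNN`) determines the conductor
outright, `RNCert.conductor c = 2^{[2 ∣ Δ]} ∏ p^{1 | 2}` (`Rank2ObservatoryConductorCert`), and the
kernel checks `c.conductor = N` on every such row (`rank3Table_condCheck`, one `decide +kernel` over
the whole table). Hence, for those rows, `hN` is DISCHARGED modulo the tree's five NAMED FACTS on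
conductor exponents, taken as hypotheses BY NAME (`conductorExponent_eq_zero_iff`, `_eq_one_iff`,
`two_le_conductorExponent_iff` — Silverman *ATAEC* IV.10.2; `conductorExponent_le_two_of_five_le_natGenerator`
— IV.10.4; `factorization_conductorNorm` — *AEC* C.16; all stated, not proved, in
`Literature.NumberTheory.DiophantineGeometry.Conductor`):

* `Rank3Row.ConductorCertified`, `Rank3Row.conductorNorm_eq_of_certified`;
* `condRowsCheck`, `rank3Table_condCheck`, `rank3Table_condCount` (`5347` tame certified rows, kernel);
* `Rank3Row.conductorCertified_of_idx`;
* `Rank3Row.rank3_lderiv_eq_zero_kernel_rnN` — the census headline with BOTH `hw` (root number,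
  `Rank2ObservatoryRank3RootNumberCensus`) and `hN` replaced by named facts + kernel certificates.

Cross-check outside the proofs (unit records): PARI `ellglobalred` (job `j096884`) returns the table
conductor for all 9 487 rows; the generator's conductor from the certificate data equals `N` on all
5 347 tame rows.

References: Silverman 1994 [Silverman1994]; Silverman 2009 [SilvermanAEC2009]; Cremona 1997
[CremonaAlgorithms1997]; Gross–Zagier–Kolyvagin as in `Rank2ObservatoryRank3KernelCertsCensus`
[GrossLMS1991].
-/

set_option linter.dupNamespace false
set_option autoImplicit false

open WeierstrassCurve IsDedekindDomain Literature Literature.NumberTheory.EllipticCurves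

namespace Summit.BirchSwinnertonDyer.BirchSwinnertonDyer.Rank2Observatory

open RootNumber

/-- A row is CONDUCTOR CERTIFIED if some root-number certificate checks on its integer model, is
tame at `2`, and certifies the table conductor `N`. [folklore] -/
def Rank3Row.ConductorCertified (r : Rank3Row) : Prop :=
  ∃ c : RNCert, c.check r.intModel = true ∧ c.tame r.intModel = true ∧ c.conductor = r.N

/-- **`N_E = N` for a conductor-certified row, modulo the five named facts on conductor exponents**
(Silverman *ATAEC* IV.10.2, IV.10.4; *AEC* C.16). [cite: Silverman1994, IV.10.2 and IV.10.4] -/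
theorem Rank3Row.conductorNorm_eq_of_certified {r : Rank3Row} (h : r.ConductorCertified)
    (h0 : ∀ v : HeightOneSpectrum ℤ, conductorExponent_eq_zero_iff v r.curve)
    (h1 : ∀ v : HeightOneSpectrum ℤ, conductorExponent_eq_one_iff v r.curve)
    (h2 : ∀ v : HeightOneSpectrum ℤ, two_le_conductorExponent_iff v r.curve)
    (h5 : ∀ v : HeightOneSpectrum ℤ, conductorExponent_le_two_of_five_le_natGenerator r.curve v)
    (hf : ∀ v : HeightOneSpectrum ℤ, factorization_conductorNorm r.curve v) :
    r.curve.conductorNorm ℤ = r.N := by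
  obtain ⟨c, hc, ht, hN⟩ := h
  rw [Rank3Row.curve_eq_baseChange] at h0 h1 h2 h5 hf ⊢
  rw [conductorNorm_eq_conductor hc ht h0 h1 h2 h5 hf, hN]

/-- The aligned conductor check: for every listed certificate that is tame on its row, the certified
conductor is the table's `N`. [folklore] -/
def condRowsCheck : List Rank3Row → List (Option RNCert) → Bool
  | [], [] => true
  | _ :: rs, none :: cs => condRowsCheck rs cs
  | r :: rs, some c :: cs => (!(c.tame r.intModel) || (c.conductor == r.N)) && condRowsCheck rs cs
  | _, _ => false

/-- What the two aligned checks say about a tame row `i`. [folklore] -/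
theorem condCertified_of_checks :
    ∀ (rows : List Rank3Row) (certs : List (Option RNCert)), rnRowsCheck rows certs = true →
      condRowsCheck rows certs = true →
      ∀ (i : ℕ) (hi : i < rows.length) (c : RNCert), certs[i]? = some (some c) →
        c.tame (rows[i]'hi).intModel = true → (rows[i]'hi).ConductorCertified
  | [], _, _, _, i, hi, _, _, _ => absurd hi (Nat.not_lt_zero i)
  | _ :: _, [], h, _, _, _, _, _, _ => by simp [rnRowsCheck] at h
  | r :: rs, none :: cs, h, h', i, hi, c, hc, ht => by
    cases i with
    | zero => simp at hc
    | succ i =>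
      simp only [rnRowsCheck] at h
      simp only [condRowsCheck] at h'
      simp only [List.getElem?_cons_succ] at hc
      simpa using condCertified_of_checks rs cs h h' i (by simpa using hi) c hc (by simpa using ht)
  | r :: rs, some c' :: cs, h, h', i, hi, c, hc, ht => by
    simp only [rnRowsCheck, Bool.and_eq_true, beq_iff_eq] at h
    simp only [condRowsCheck, Bool.and_eq_true, Bool.or_eq_true, Bool.not_eq_true', beq_iff_eq] at h'
    cases i with
    | zero =>
      simp only [List.getElem?_cons_zero, Option.some.injEq] at hc
      subst hc
      simp only [List.getElem_cons_zero] at ht ⊢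
      rcases h'.1 with hnt | hN
      · rw [hnt] at ht; exact absurd ht Bool.false_ne_true
      · exact ⟨c', h.1.1, ht, hN⟩
    | succ i =>
      simp only [List.getElem?_cons_succ] at hc
      simpa using condCertified_of_checks rs cs h.2 h'.2 i (by simpa using hi) c hc (by simpa using ht)

/-- **The conductor check passes on the whole census** (one kernel evaluation over the 9 487 rows).
[cite: CremonaAlgorithms1997, Tables] -/
theorem rank3Table_condCheck : condRowsCheck rank3Table rank3RNCerts = true := by
  decide +kernel

/-- **Exactly `5347` rows are tame with a certificate** (kernel count): those for which `hN` is
discharged below. [cite: CremonaAlgorithms1997, Tables] -/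
theorem rank3Table_condCount :
    ((rank3Table.zip rank3RNCerts).countP fun rc =>
      match rc.2 with
      | some c => c.tame rc.1.intModel
      | none => false) = 5347 := by
  decide +kernel

/-- Row `i` with a listed certificate tame on it is conductor certified. [folklore] -/
theorem Rank3Row.conductorCertified_of_idx {i : ℕ} (hi : i < rank3Table.length) {c : RNCert}
    (hc : rank3RNCerts[i]? = some (some c)) (ht : c.tame (rank3Table[i]'hi).intModel = true) :
    (rank3Table[i]'hi).ConductorCertified :=
  condCertified_of_checks _ _ rank3Table_rnCheck rank3Table_condCheck i hi c hc ht

/-- **`L′(E,1) = 0` over `K = ℚ(√D)` for every row of the rank-3 census that is root-number AND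
conductor certified** — the census headline `Rank3Row.rank3_lderiv_eq_zero_kernel` with `hw`
replaced by the Kellock–Dokchitser named fact `hKD` and `hN` replaced by the five named facts on
conductor exponents; the remaining hypotheses are modularity `hE`, Gross–Zagier–Kolyvagin over `K`
(`hGZKK`), global minimality of the model (`hmin`), `K` (`hK`, `hdK`) and the twist value `hLD`.
[cite: GrossLMS1991, (1.1) and Thm. 1.3] [cite: Silverman1994, IV.10.2 and IV.10.4] -/
theorem Rank3Row.rank3_lderiv_eq_zero_kernel_rnN {r : Rank3Row} (hr : r ∈ rank3Table)
    (hrc : r.RootNumberCertified) (hcc : r.ConductorCertified) (K : Type) [Field K] [NumberField K]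
    (hE : WeierstrassCurve.hasEntireLFunction_rat)
    (hGZKK : mordellWeilRank_eq_one_of_LDerivEK_ne_zero r.curve K)
    (hmin : r.curve.IsGloballyMinimal)
    (h0 : ∀ v : HeightOneSpectrum ℤ, conductorExponent_eq_zero_iff v r.curve)
    (h1 : ∀ v : HeightOneSpectrum ℤ, conductorExponent_eq_one_iff v r.curve)
    (h2 : ∀ v : HeightOneSpectrum ℤ, two_le_conductorExponent_iff v r.curve)
    (h5 : ∀ v : HeightOneSpectrum ℤ, conductorExponent_le_two_of_five_le_natGenerator r.curve v)
    (hf : ∀ v : HeightOneSpectrum ℤ, factorization_conductorNorm r.curve v)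
    (hK : IsImaginaryQuadratic K) (hdK : NumberField.discr K = r.D)
    (hKD : r.curve.rootNumber_eq_neg_finprod_tableLocalRootNumberAt')
    (hLD : (r.curve.quadraticTwist (r.D : ℚ)).entireLFunction 1 ≠ 0) :
    deriv r.curve.entireLFunction 1 = 0 :=
  Rank3Row.rank3_lderiv_eq_zero_kernel_rn hr hrc K hE hGZKK hmin
    (Rank3Row.conductorNorm_eq_of_certified hcc h0 h1 h2 h5 hf) hK hdK hKD hLD

/-- The first row, `5077a1`, is conductor certified (certificate `⟨0, 4, 3, [(5077: non-split)]⟩`,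
tame, conductor `5077`; kernel). [cite: CremonaAlgorithms1997, Tables] -/
theorem conductorCertified_5077a1 :
    (⟨"5077a1", 0, 0, 1, -7, 6, 5077, -7, 4792, (1, 0, 1), (2, 0, 1), (0, 2, 1)⟩ : Rank3Row).ConductorCertified :=
  ⟨⟨0, 4, 3, [⟨5077, 71, 1, 0, 0⟩]⟩, by decide +kernel, by decide +kernel, by decide +kernel⟩

end Summit.BirchSwinnertonDyer.BirchSwinnertonDyer.Rank2Observatory
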